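import Mathlib.Data.Rat.Defs
import Mathlib.Data.Finset.Basic
import Mathlib.Tactic.Linarith
import Mathlib.Tactic.NormNum
import Mathlib.Tactic.IntervalCases
import Mathlib.Tactic.FieldSimp
import HarnessLib

/-!
# The emission table at the Frobenius point `(5, 1/25)`: weight arithmetic (T30 core)

Uniform value line: INSTRUMENT — kernel-checked WEIGHT ARITHMETIC for the polynomial
weighted-centre model `W(f)` of the cell (engine 1's toy model: THEOREM-FS-eng1-g35 §10.4b, the
EMISSION TABLE at `(p, ρ) = (5, 1/25)` and its CONSEQUENCES (a), (b), the PINS remark and the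
`V`-emission remark; CARVER-NOTES-eng1-g35 T30 "four lemmas over `ℚ` with interval hypotheses") —
NOT a resolution theorem, NOT a statement about the Abramovich–Temkin–Włodarczyk invariant, NOT
summit progress; AI-written Lean, AI review is weaker than expert review.  The polynomial side of
the four readings (T25's extraction identity) is NOT here; this file is only the legal-weight
arithmetic that produces the source lists.

## Dictionary (weights in units of `ρ = 1/25`, as rationals)

* legal slot weights of the model: `(0, 1/5] ∪ U`, `U = {5/24, 2/9, 1/4, 1/3, 1/2}` (LEMMA G) ↦
  `Legal25 w := (0 < w ∧ w ≤ 5) ∨ w ∈ U25`, `U25 = {125/24, 50/9, 25/4, 25/3, 25/2}`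
  (`N = 5.208…, N' = 5.555…, W = 6.25, M = 8.333…, V = 12.5`); the classes `A = 3`, `Z = 4`, `F = 5`
  are the dense integer weights `≥ w⋆ = 3`.
* a slot of weight `w` EMITS `σ^a · κ` (`a ≥ 1`, `κ` a monomial in slots, `wt κ = w − a`); a PURE
  emission has `κ = 1`, i.e. `w = a ∈ ℕ`.

## Content

* (b) `natCast_le_five_of_legal25`: a legal INTEGER weight is `≤ 5` — pure emissions come only from
  the dense classes `1, …, 5` (with slots `≥ w⋆ = 3`: from `A`, `Z`, `F`); no `U`-slot emits purely.
* (a) `legal25_sub_ne_natCast`: `w − a` is never an integer `≥ 5` for `w` legal and `a ≥ 1` — so an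
  emission `σ^a κ` whose variables all lie in `A ∪ Z ∪ F` (integer `wt κ = 5·#F + 4·#Z + 3·#A`)
  contains NO `F`-variable: in an output over `A ∪ Z ∪ F` every `F`-variable is a KEPT factor.
* (d) `F_emission_classification`: if `w − a = 5k + r` with `k ≥ 1` `F`-variables and a companion
  part `r` that is `0` or realisable (`r ≥ 3 = w⋆` and: `r` legal, or `r ≥ 6` for `≥ 2` companions),
  then `w = 25/2 = V`, `k = 1` and `(a, r) ∈ {(1, 13/2), (3, 9/2), (4, 7/2)}` — the only emissions
  anywhere containing an `F`-variable, each with a DENSE companion.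
* (c) `heavy_legal25_mem` + `F_pins`: legal weights `≥ 5` are `{5} ∪ U25` (scaled by `72`:
  `{360, 375, 400, 450, 600, 900}`), and the only multiset of them of total weight `20` (`1440`) is
  `{5, 5, 5, 5}`: the pins of an `F`-slot are `ε_f ×` (`F`-quartic).

References (context only; elementary arithmetic decided here): [AbramovichTemkinWlodarczyk2024] §5
(weights of a weighted centre); [Wlodarczyk2022] (weighted centres in arbitrary characteristic).
-/

namespace Literature.AlgebraicGeometry.Resolution.WeightedBlowup

namespace Emission25

/-- `U = {5/24, 2/9, 1/4, 1/3, 1/2}` in units of `1/25`. [cite: AbramovichTemkinWlodarczyk2024, §5] -/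
def U25 : Finset ℚ := {125/24, 50/9, 25/4, 25/3, 25/2}

/-- Legal slot weights `(0, 1/5] ∪ U` in units of `1/25`. [cite: AbramovichTemkinWlodarczyk2024, §5] -/
def Legal25 (w : ℚ) : Prop := (0 < w ∧ w ≤ 5) ∨ w ∈ U25

/-- `Legal25` is decidable (a disjunction of rational comparisons). [cite: AbramovichTemkinWlodarczyk2024, §5] -/
instance instDecidablePredLegal25 : DecidablePred Legal25 :=
  fun _ => inferInstanceAs (Decidable (_ ∨ _))

/-- (derived here) [cite: AbramovichTemkinWlodarczyk2024, §5] -/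
theorem mem_U25 {w : ℚ} : w ∈ U25 ↔ w = 125/24 ∨ w = 50/9 ∨ w = 25/4 ∨ w = 25/3 ∨ w = 25/2 := by
  simp [U25]

/-- Every `U`-weight exceeds `5 = 1/5` and is at most `25/2 = 1/2` (decided here).
[cite: AbramovichTemkinWlodarczyk2024, §5] -/
theorem five_lt_of_mem_U25 {w : ℚ} (h : w ∈ U25) : 5 < w ∧ w ≤ 25/2 := by
  rcases mem_U25.mp h with rfl | rfl | rfl | rfl | rfl <;> constructor <;> norm_num

/-- No `U`-weight is an integer multiple of `ρ = 1/25` (decided here).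
[cite: AbramovichTemkinWlodarczyk2024, §5] -/
theorem natCast_notMem_U25 (n : ℕ) : (n : ℚ) ∉ U25 := by
  intro h
  rcases mem_U25.mp h with h | h | h | h | h
  · have h' : ((24 * n : ℕ) : ℚ) = ((125 : ℕ) : ℚ) := by push_cast; rw [h]; norm_num
    have := (Nat.cast_injective (R := ℚ)) h'
    omega
  · have h' : ((9 * n : ℕ) : ℚ) = ((50 : ℕ) : ℚ) := by push_cast; rw [h]; norm_num
    have := (Nat.cast_injective (R := ℚ)) h'
    omega
  · have h' : ((4 * n : ℕ) : ℚ) = ((25 : ℕ) : ℚ) := by push_cast; rw [h]; norm_num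
    have := (Nat.cast_injective (R := ℚ)) h'
    omega
  · have h' : ((3 * n : ℕ) : ℚ) = ((25 : ℕ) : ℚ) := by push_cast; rw [h]; norm_num
    have := (Nat.cast_injective (R := ℚ)) h'
    omega
  · have h' : ((2 * n : ℕ) : ℚ) = ((25 : ℕ) : ℚ) := by push_cast; rw [h]; norm_num
    have := (Nat.cast_injective (R := ℚ)) h'
    omega

/-- **(b) Pure emissions.** A legal integer weight (units `1/25`) is at most `5`: a pure emission
`σ^a` (`a = w ∈ ℕ`) comes only from a slot of a dense class `1, …, 5`; no `U`-slot emits purely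
(derived here). [cite: AbramovichTemkinWlodarczyk2024, §5] -/
theorem natCast_le_five_of_legal25 (n : ℕ) (h : Legal25 (n : ℚ)) : n ≤ 5 := by
  rcases h with h | h
  · exact_mod_cast h.2
  · exact absurd h (natCast_notMem_U25 n)

/-- **(a) `F`-variables are kept.** For `w` legal and `a ≥ 1`, `w − a` is never an integer `N ≥ 5`;
in particular an emission `σ^a κ` never has all variables of `κ` in `A ∪ Z ∪ F` with an `F` among
them (`wt κ = 3·#A + 4·#Z + 5·#F ≥ 5`), so in an output over `A ∪ Z ∪ F` every `F`-variable is
a kept factor of the source monomial (derived here). [cite: AbramovichTemkinWlodarczyk2024, §5] -/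
theorem legal25_sub_ne_natCast (w : ℚ) (hw : Legal25 w) (a N : ℕ) (ha : 1 ≤ a) (hN : 5 ≤ N) :
    w - a ≠ N := by
  intro h
  have hw' : w = ((a + N : ℕ) : ℚ) := by push_cast; linarith
  have := natCast_le_five_of_legal25 (a + N) (hw' ▸ hw)
  omega

/-- **(d) The emissions containing an `F`-variable.**  If a slot of legal weight `w` emits
`σ^a · ε_F^k · (companions of total weight r)`, `a ≥ 1`, `k ≥ 1`, where the companion part is empty
(`r = 0`) or realisable by slots `≥ w⋆ = 3` (`r ≥ 3`, and `r` is itself legal or `r ≥ 6`), then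
`w = V = 25/2`, `k = 1` and `(a, r) ∈ {(1, 13/2), (3, 9/2), (4, 7/2)}` — each with a (necessarily
dense) companion (derived here). [cite: AbramovichTemkinWlodarczyk2024, §5] -/
theorem F_emission_classification (w : ℚ) (hw : Legal25 w) (a k : ℕ) (ha : 1 ≤ a) (hk : 1 ≤ k)
    (hr : w - a - 5 * k = 0 ∨
      (3 ≤ w - a - 5 * k ∧ (Legal25 (w - a - 5 * k) ∨ 6 ≤ w - a - 5 * k))) :
    w = 25/2 ∧ k = 1 ∧
      ((a = 1 ∧ w - a - 5 * k = 13/2) ∨ (a = 3 ∧ w - a - 5 * k = 9/2) ∨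
        (a = 4 ∧ w - a - 5 * k = 7/2)) := by
  have ha' : (1 : ℚ) ≤ a := by exact_mod_cast ha
  have hk' : (1 : ℚ) ≤ k := by exact_mod_cast hk
  -- integrality: `w - a - 5k = 0` forces `w` to be a natural number
  have hint : w - a - 5 * k = 0 → w = ((a + 5 * k : ℕ) : ℚ) := fun h => by push_cast; linarith
  have hr3 : w - a - 5 * k = 0 ∨ 3 ≤ w - a - 5 * k := hr.imp_right And.left
  rcases hw with hw | hw
  · -- dense slot: `w ≤ 5 < a + 5k`
    exfalso; rcases hr3 with h | h <;> nlinarith [hw.2]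
  rcases mem_U25.mp hw with rfl | rfl | rfl | rfl | rfl
  · exfalso; rcases hr3 with h | h <;> nlinarith
  · exfalso; rcases hr3 with h | h <;> nlinarith
  · exfalso
    rcases hr3 with h | h
    · exact natCast_notMem_U25 _ ((hint h) ▸ hw)
    · nlinarith
  · exfalso
    rcases hr3 with h | h
    · exact natCast_notMem_U25 _ ((hint h) ▸ hw)
    · nlinarith
  · -- `w = V = 25/2`
    have hk1 : k = 1 := by
      by_contra hk1
      have hk2 : (2 : ℚ) ≤ k := by exact_mod_cast (show 2 ≤ k by omega)
      rcases hr3 with h | h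
      · exact natCast_notMem_U25 _ ((hint h) ▸ hw)
      · nlinarith
    subst hk1
    refine ⟨rfl, rfl, ?_⟩
    have ha7 : a ≤ 4 := by
      by_contra ha7
      have ha5 : (5 : ℚ) ≤ a := by exact_mod_cast (show 5 ≤ a by omega)
      rcases hr3 with h | h
      · exact natCast_notMem_U25 _ ((hint h) ▸ hw)
      · push_cast at h; nlinarith
    interval_cases a
    · left; constructor; · rfl
      push_cast; norm_num
    · -- `a = 2`: companion weight `11/2` is neither `0`, nor legal, nor `≥ 6`
      exfalso
      rcases hr with h | ⟨-, h | h⟩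
      · push_cast at h; norm_num at h
      · rcases h with h | h
        · push_cast at h; norm_num at h
        · have := five_lt_of_mem_U25 h
          rcases mem_U25.mp h with h' | h' | h' | h' | h' <;> push_cast at h' <;> norm_num at h'
      · push_cast at h; norm_num at h
    · right; left; constructor; · rfl
      push_cast; norm_num
    · right; right; constructor; · rfl
      push_cast; norm_num

/-- **(c), dictionary half.** A legal weight `≥ 5 = 1/5` is `5` or a `U`-weight; scaled by `72`
it lies in `{360, 375, 400, 450, 600, 900}` (derived here). [cite: AbramovichTemkinWlodarczyk2024, §5] -/
theorem heavy_legal25_mem (w : ℚ) (hw : Legal25 w) (h5 : 5 ≤ w) :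
    72 * w ∈ ({360, 375, 400, 450, 600, 900} : Finset ℚ) := by
  rcases hw with hw | hw
  · have : w = 5 := le_antisymm hw.2 h5
    subst this; norm_num
  · rcases mem_U25.mp hw with rfl | rfl | rfl | rfl | rfl <;> norm_num

/-- All lists of length `≤ n` over the alphabet `S`. [cite: AbramovichTemkinWlodarczyk2024, §5] -/
def listsUpTo : ℕ → List ℕ → List (List ℕ)
  | 0, _ => [[]]
  | n + 1, S => [] :: S.flatMap fun x => (listsUpTo n S).map (x :: ·)

/-- (derived here) [cite: AbramovichTemkinWlodarczyk2024, §5] -/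
theorem mem_listsUpTo {S : List ℕ} : ∀ {l : List ℕ} {n : ℕ}, (∀ x ∈ l, x ∈ S) → l.length ≤ n →
    l ∈ listsUpTo n S
  | [], 0, _, _ => by simp [listsUpTo]
  | [], _ + 1, _, _ => by simp [listsUpTo]
  | _ :: _, 0, _, h => by simp at h
  | x :: l, n + 1, hS, h => by
    simp only [listsUpTo, List.mem_cons, List.mem_flatMap, List.mem_map, List.cons.injEq]
    right
    exact ⟨x, hS x (by simp), l, mem_listsUpTo (fun y hy => hS y (by simp [hy])) (by simpa using h),
      rfl, rfl⟩

/-- **(c) Pins of an `F`-slot.**  A list of heavy legal weights (scaled by `72`: alphabet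
`{360, 375, 400, 450, 600, 900}` = `{F} ∪ U`) of total `1440 = 72·20` is `[360, 360, 360, 360]`:
the weight-`20` complements of `ε_f` in a value-`1` monomial over slots `≥ 5` are exactly the
`F`-quartics, so the pins of `f` are the monomials `ε_f × F-quartic` of the `F`-quintic part `H`
(decided here). [cite: AbramovichTemkinWlodarczyk2024, §5] -/
theorem F_pins (l : List ℕ) (hS : ∀ x ∈ l, x ∈ [360, 375, 400, 450, 600, 900]) (hsum : l.sum = 1440) :
    l = [360, 360, 360, 360] := by
  -- each letter is `≥ 360`, so `l.length ≤ 4`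
  have hlen : 360 * l.length ≤ l.sum := by
    clear hsum
    induction l with
    | nil => simp
    | cons x l ih =>
      have hx : 360 ≤ x := by
        have := hS x (by simp)
        simp only [List.mem_cons, List.not_mem_nil, or_false] at this
        omega
      have := ih (fun y hy => hS y (by simp [hy]))
      simp only [List.length_cons, List.sum_cons]
      omega
  have h4 : l.length ≤ 4 := by omega
  have key : ((listsUpTo 4 [360, 375, 400, 450, 600, 900]).all
      fun l' => l'.sum != 1440 || l' == [360, 360, 360, 360]) = true := by
    decide +kernel
  have := List.all_eq_true.mp key l (mem_listsUpTo hS h4)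
  simp only [Bool.or_eq_true, bne_iff_ne, ne_eq, beq_iff_eq] at this
  exact this.resolve_left fun h => h hsum

end Emission25

end Literature.AlgebraicGeometry.Resolution.WeightedBlowup
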